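import Mathlib.Analysis.Convex.Caratheodory
import Mathlib.Analysis.Convex.Integral
import Mathlib.Analysis.Complex.Exponential
import Mathlib.LinearAlgebra.AffineSpace.FiniteDimensional
import Mathlib.MeasureTheory.Integral.Bochner.ContinuousLinearMap
import Mathlib.MeasureTheory.Measure.Dirac
import Literature.Geometry.Manifold.ClarkeJacobianSemicontinuity

/-!
# YM-DAG node N19 (= NE7 proper) — TCHAKALOFF CUBATURE: a probability law on a box has, for every total degree `t`, an atomic
# law on AT MOST `#{j : Σ j_i ≤ t} + 1 ≤ (e(t+d)∕d)^d + 1` points of the box with THE SAME mixed moments of total degree `≤ t`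

Cell `pub-ymgap`, HUMAN RULING D-0062 (Track A) ∕ D-0149 (work-bound push), R141 (C) wider-strategy seat `pub-ymgap-dag-n19-e` (strategy
s3 = ALTERNATIVE CURRENCY), generation g27, module 1 (lineage module 106).  Route `Summits/QuantumFields/YangMills/Theses/BalabanUVNodes.lean`,
cluster item K3⁸ «SpineGivenEndpointR13SepCoPHV» (stmt-QuantumFields-27366); filed `--supports` that item `--as helper` (it proves no registered
stub).  COUNT-NEUTRAL: [folklore] convex geometry (Tchakaloff 1957 via Carathéodory) over Mathlib (`eq_pos_convex_span_of_mem_convexHull`,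
`AffineIndependent.card_le_finrank_succ`, `Convex.integral_mem`) and the tree's `Literature.Geometry.Manifold.isCompact_convexHull_of_isCompact`
BY NAME; no scheme object, no Theses import; NOT a discharge claim.

WHY (the lineage's open item (v), CURRENCY-MAP v5).  Module 65 (p584370) prices `|ι|` strings jointly under UNIFORM MIXED MOMENTS at
`(76K|ι|² + 12G|ι|)∕(1 + log r⁻¹)` for ℓ¹-Lipschitz functionals, module 66 (p585362) shows the ADDITIVE class is `Θ(|ι|∕log r⁻¹)`; whether the
general class is `|ι|` or `|ι|²` stayed open since g21 because every PRODUCT witness reduces to one dimension.  The non-product witness is a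
CUBATURE FORMULA: few atoms, all low mixed moments of the uniform law reproduced EXACTLY.  This module supplies it; the sibling module 107
`…N19JointLawPriceDimensionSharp` turns it into the `|ι|²` lower bound by a volume count.

CONTENTS (`d = |ι| ≥ 1`; the exponent vectors of total degree `≤ t` are the finite set
`MI t := ((Fintype.piFinset fun _ => range (t+1)).filter fun j => Σ_i j_i ≤ t)`, written out in full below — 0 `def`).
§1 `mem_multiIndex_iff` · ★ `card_multiIndex_le`: `#MI t ≤ (e(t+d)∕d)^d` — the generating-function count: `q^t·#MI t ≤ (Σ_{a≤t} q^a)^d ≤ (1−q)^{−d}`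
   (`Finset.prod_univ_sum`, `mul_neg_geom_sum`) at `q = t∕(t+d)`, and `((t+d)∕t)^t = (1 + d∕t)^t ≤ e^d` (`Real.add_one_le_exp`).  (The BOX count
   `(t+1)^d` would only reproduce the product road; the whole point of (v) is total degree.)
§2 ★★ `exists_tchakaloff_cubature`: for a probability law `Q` on `ι → ℝ` carried by the box `[a,b]^ι` and every `t : ℕ` there are
   `N ≤ #MI t + 1` atoms `z_k ∈ [a,b]^ι` and weights `w_k > 0`, `Σ w_k = 1`, with `Σ_k w_k ∏_i z_{k,i}^{j_i} = ∫∏_i x_i^{j_i} dQ` for EVERY `j` with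
   `Σ j_i ≤ t` — Carathéodory in the moment space `ℝ^{MI t}`: the moment vector `∫(x^j)_j dQ` lies in `conv(moment surface)` (Mathlib's
   `Convex.integral_mem`; the hull is compact by the tree's `isCompact_convexHull_of_isCompact`), and a point of the hull of a set in `ℝ^D` is a
   positive combination of `≤ D + 1` affinely independent points of the set.  ★ `exists_tchakaloff_cubature_explicit`: the same with
   `N ≤ (e(t+d)∕d)^d + 1`.  ★ `exists_cubature_measure`: packaged as a probability MEASURE `P = Σ_k w_k δ_{z_k}` carried by the box, with
   `∫f dP = Σ_k w_k f(z_k)` for every `f` and equal moments of total degree `≤ t`.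

HONEST FRAMING (binding).  Elementary and [folklore]; TOY objects (an arbitrary law on a box, finitely many atoms); NO consumer in the DAG today
(a tool for an optimality statement about the seat's own currency); nothing of Bałaban's instantiated; NE7 NOT PRINTED, NOT proved; N19 NOT
discharged; count-neutral.  One finite `T⁴` programme at fixed `ε`; nothing continuum ∕ `ℝ⁴` ∕ OS ∕ mass-gap ∕ Clay.  0 `def` ∕ 0 `sorry`.
-/

noncomputable section

open Real Finset MeasureTheory

namespace Summit.QuantumFields.YangMills.Theorems.BalabanUVNodesN19TchakaloffCubature

open Literature.Geometry.Manifold (isCompact_convexHull_of_isCompact)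

variable {ι : Type*} [Fintype ι] [DecidableEq ι]

/-! ## §1 Exponent vectors of total degree `≤ t`: membership and the count `#MI t ≤ (e(t+d)∕d)^d` [folklore] -/

omit [DecidableEq ι] in
/-- A term of a sum of naturals is at most the sum. [bookkeeping] -/
theorem le_sum_of_mem (j : ι → ℕ) (i : ι) : j i ≤ ∑ k, j k :=
  Finset.single_le_sum (f := j) (fun _ _ => Nat.zero_le _) (Finset.mem_univ i)

/-- Membership in the set of exponent vectors of total degree `≤ t`: `j ∈ MI t ↔ Σ_i j_i ≤ t` (the box condition `j_i ≤ t` is automatic).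
[bookkeeping] -/
theorem mem_multiIndex_iff (t : ℕ) (j : ι → ℕ) :
    j ∈ ((Fintype.piFinset fun _ : ι => Finset.range (t + 1)).filter fun j : ι → ℕ => ∑ i, j i ≤ t) ↔ ∑ i, j i ≤ t := by
  simp only [Finset.mem_filter, Fintype.mem_piFinset, Finset.mem_range, and_iff_right_iff_imp]
  intro h i
  exact lt_of_le_of_lt ((le_sum_of_mem j i).trans h) (Nat.lt_succ_self t)

/-- The generating-function inequality: for `0 ≤ q ≤ 1`, `q^t · #MI t ≤ (Σ_{a ≤ t} q^a)^d`. [folklore] -/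
theorem pow_mul_card_multiIndex_le (t : ℕ) {q : ℝ} (hq0 : 0 ≤ q) (hq1 : q ≤ 1) :
    q ^ t * (((Fintype.piFinset fun _ : ι => Finset.range (t + 1)).filter fun j : ι → ℕ => ∑ i, j i ≤ t).card : ℝ) ≤
      (∑ a ∈ Finset.range (t + 1), q ^ a) ^ Fintype.card ι := by
  classical
  set S := (Fintype.piFinset fun _ : ι => Finset.range (t + 1)).filter fun j : ι → ℕ => ∑ i, j i ≤ t with hS
  calc q ^ t * (S.card : ℝ) = ∑ j ∈ S, q ^ t := by rw [Finset.sum_const, nsmul_eq_mul, mul_comm]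
    _ ≤ ∑ j ∈ S, q ^ (∑ i, j i) := by
        refine Finset.sum_le_sum fun j hj => ?_
        exact pow_le_pow_of_le_one hq0 hq1 ((mem_multiIndex_iff t j).1 hj)
    _ ≤ ∑ j ∈ Fintype.piFinset (fun _ : ι => Finset.range (t + 1)), q ^ (∑ i, j i) :=
        Finset.sum_le_sum_of_subset_of_nonneg (Finset.filter_subset _ _) fun j _ _ => pow_nonneg hq0 _
    _ = ∑ j ∈ Fintype.piFinset (fun _ : ι => Finset.range (t + 1)), ∏ i, q ^ j i := by
        refine Finset.sum_congr rfl fun j _ => ?_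
        rw [Finset.prod_pow_eq_pow_sum]
    _ = ∏ _i : ι, ∑ a ∈ Finset.range (t + 1), q ^ a :=
        (Finset.prod_univ_sum (fun _ : ι => Finset.range (t + 1)) (fun _ a => q ^ a)).symm
    _ = (∑ a ∈ Finset.range (t + 1), q ^ a) ^ Fintype.card ι := by
        rw [Finset.prod_const, Finset.card_univ]

/-- ★ THE COUNT: `#{j : ι → ℕ, Σ_i j_i ≤ t} ≤ (e·(t + d)∕d)^d` (`d = |ι| ≥ 1`) — `q^t·# ≤ (1 − q)^{−d}` at `q = t∕(t+d)`, with
`(1 + d∕t)^t ≤ e^d`.  (Exact value `C(t+d, d)`; this bound is all the sibling module needs.) [folklore] -/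
theorem card_multiIndex_le [Nonempty ι] (t : ℕ) :
    (((Fintype.piFinset fun _ : ι => Finset.range (t + 1)).filter fun j : ι → ℕ => ∑ i, j i ≤ t).card : ℝ) ≤
      (Real.exp 1 * (t + Fintype.card ι) / Fintype.card ι) ^ Fintype.card ι := by
  classical
  set S := (Fintype.piFinset fun _ : ι => Finset.range (t + 1)).filter fun j : ι → ℕ => ∑ i, j i ≤ t with hS
  set d : ℕ := Fintype.card ι with hd
  have hd1 : 1 ≤ d := Fintype.card_pos
  have hdpos : (0 : ℝ) < d := by exact_mod_cast hd1
  have he1 : (1 : ℝ) ≤ Real.exp 1 := Real.one_le_exp (by norm_num)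
  rcases Nat.eq_zero_or_pos t with ht | ht
  · -- `t = 0`: the only exponent vector is `0`
    subst ht
    have hcard : S.card ≤ 1 := by
      refine Finset.card_le_one.2 fun j hj k hk => ?_
      have hj0 := (mem_multiIndex_iff 0 j).1 hj
      have hk0 := (mem_multiIndex_iff 0 k).1 hk
      funext i
      have h1 : j i = 0 := Nat.eq_zero_of_le_zero ((le_sum_of_mem j i).trans hj0)
      have h2 : k i = 0 := Nat.eq_zero_of_le_zero ((le_sum_of_mem k i).trans hk0)
      rw [h1, h2]
    have h1 : (S.card : ℝ) ≤ 1 := by exact_mod_cast hcard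
    calc (S.card : ℝ) ≤ 1 := h1
      _ = 1 ^ d := (one_pow d).symm
      _ ≤ (Real.exp 1 * ((0 : ℕ) + d) / d) ^ d := by
          refine pow_le_pow_left₀ (by norm_num) ?_ d
          rw [Nat.cast_zero, zero_add, mul_div_assoc, div_self hdpos.ne', mul_one]
          exact he1
  · -- `t ≥ 1`: `q = t∕(t+d)`
    have htpos : (0 : ℝ) < t := by exact_mod_cast ht
    have htd : (0 : ℝ) < t + d := by positivity
    set q : ℝ := t / (t + d) with hq
    have hq0 : 0 ≤ q := div_nonneg htpos.le htd.le
    have hq1 : q < 1 := (div_lt_one htd).2 (by linarith)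
    have hq1' : 1 - q = d / (t + d) := by
      rw [hq]; field_simp; ring
    -- geometric sum ≤ (t+d)∕d
    have hgeom : ∑ a ∈ Finset.range (t + 1), q ^ a ≤ (t + d) / d := by
      have h := mul_neg_geom_sum q (t + 1)
      have hle : (1 - q) * ∑ a ∈ Finset.range (t + 1), q ^ a ≤ 1 := by
        rw [h]; linarith [pow_nonneg hq0 (t + 1)]
      rw [hq1'] at hle
      rw [le_div_iff₀ hdpos]
      have := mul_le_mul_of_nonneg_left hle htd.le
      calc (∑ a ∈ Finset.range (t + 1), q ^ a) * d = (t + d) * (d / (t + d) * ∑ a ∈ Finset.range (t + 1), q ^ a) := by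
            field_simp
        _ ≤ (t + d) * 1 := this
        _ = t + d := mul_one _
    have hgeom0 : 0 ≤ ∑ a ∈ Finset.range (t + 1), q ^ a := Finset.sum_nonneg fun a _ => pow_nonneg hq0 a
    -- `q^{-t} ≤ e^d`
    have hqt : 1 ≤ Real.exp 1 ^ d * q ^ t := by
      have h1 : (1 : ℝ) + d / t ≤ Real.exp (d / t) := by
        have := Real.add_one_le_exp ((d : ℝ) / t); linarith
      have h2 : (1 + (d : ℝ) / t) ^ t ≤ Real.exp 1 ^ d := by
        calc (1 + (d : ℝ) / t) ^ t ≤ Real.exp (d / t) ^ t := pow_le_pow_left₀ (by positivity) h1 t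
          _ = Real.exp 1 ^ d := by
              rw [← Real.exp_nat_mul, ← Real.exp_nat_mul, mul_one]
              congr 1; field_simp
      have h3 : (1 + (d : ℝ) / t) * q = 1 := by
        rw [hq]; field_simp
      calc (1 : ℝ) = ((1 + (d : ℝ) / t) * q) ^ t := by rw [h3, one_pow]
        _ = (1 + (d : ℝ) / t) ^ t * q ^ t := mul_pow _ _ _
        _ ≤ Real.exp 1 ^ d * q ^ t := mul_le_mul_of_nonneg_right h2 (pow_nonneg hq0 t)
    have hmain := pow_mul_card_multiIndex_le (ι := ι) t hq0 hq1.le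
    rw [← hS, ← hd] at hmain
    have hcard0 : (0 : ℝ) ≤ S.card := Nat.cast_nonneg _
    calc (S.card : ℝ) = 1 * S.card := (one_mul _).symm
      _ ≤ (Real.exp 1 ^ d * q ^ t) * S.card := mul_le_mul_of_nonneg_right hqt hcard0
      _ = Real.exp 1 ^ d * (q ^ t * S.card) := by ring
      _ ≤ Real.exp 1 ^ d * (∑ a ∈ Finset.range (t + 1), q ^ a) ^ d :=
          mul_le_mul_of_nonneg_left hmain (pow_nonneg (by positivity) d)
      _ ≤ Real.exp 1 ^ d * ((t + d) / d) ^ d :=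
          mul_le_mul_of_nonneg_left (pow_le_pow_left₀ hgeom0 hgeom d) (pow_nonneg (by positivity) d)
      _ = (Real.exp 1 * (t + d) / d) ^ d := by rw [← mul_pow, mul_div_assoc]

/-! ## §2 Tchakaloff's theorem on a box [folklore] -/

/-- ★★ **TCHAKALOFF CUBATURE.**  A probability law `Q` on `ι → ℝ` carried by the box `[a,b]^ι` has, for every `t : ℕ`, an atomic law with at
most `#{j : Σ_i j_i ≤ t} + 1` atoms IN THE BOX and positive weights reproducing EVERY mixed moment of total degree `≤ t`:
`Σ_k w_k ∏_i z_{k,i}^{j_i} = ∫ ∏_i x_i^{j_i} dQ` whenever `Σ_i j_i ≤ t`.  Carathéodory's theorem in the moment space `ℝ^{#MI t}`, the moment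
vector of `Q` lying in the (compact) convex hull of the moment surface `{(z^j)_j : z ∈ [a,b]^ι}`. [folklore] -/
theorem exists_tchakaloff_cubature {a b : ℝ} (Q : Measure (ι → ℝ)) [IsProbabilityMeasure Q]
    (hQ : Q (Set.pi Set.univ (fun _ : ι => Set.Icc a b))ᶜ = 0) (t : ℕ) :
    ∃ (N : ℕ) (w : Fin N → ℝ) (z : Fin N → ι → ℝ),
      N ≤ ((Fintype.piFinset fun _ : ι => Finset.range (t + 1)).filter fun j : ι → ℕ => ∑ i, j i ≤ t).card + 1 ∧
      (∀ k, 0 < w k) ∧ ∑ k, w k = 1 ∧ (∀ k i, z k i ∈ Set.Icc a b) ∧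
      ∀ j : ι → ℕ, ∑ i, j i ≤ t → ∑ k, w k * ∏ i, z k i ^ j i = ∫ x, ∏ i, x i ^ j i ∂Q := by
  classical
  set S := (Fintype.piFinset fun _ : ι => Finset.range (t + 1)).filter fun j : ι → ℕ => ∑ i, j i ≤ t with hS
  -- the moment map into `ℝ^S`
  set m : (ι → ℝ) → (S → ℝ) := fun x j => ∏ i, x i ^ (j : ι → ℕ) i with hm
  have hmc : Continuous m :=
    continuous_pi fun j => continuous_finsetProd _ fun i _ => (continuous_apply i).pow _
  set K : Set (ι → ℝ) := Set.pi Set.univ (fun _ : ι => Set.Icc a b) with hK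
  have hKc : IsCompact K := isCompact_univ_pi fun _ => isCompact_Icc
  have hC : IsCompact (convexHull ℝ (m '' K)) := isCompact_convexHull_of_isCompact (hKc.image hmc)
  -- the moment vector of `Q` lies in the hull
  have hae : ∀ᵐ x ∂Q, x ∈ K := mem_ae_iff.2 hQ
  obtain ⟨C, hCb⟩ := hKc.exists_bound_of_continuousOn hmc.continuousOn
  have hint : Integrable m Q :=
    ⟨hmc.aestronglyMeasurable, HasFiniteIntegral.of_bounded (hae.mono fun x hx => hCb x hx)⟩
  have hmem : ∫ x, m x ∂Q ∈ convexHull ℝ (m '' K) :=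
    (convex_convexHull ℝ _).integral_mem hC.isClosed
      (hae.mono fun x hx => subset_convexHull ℝ _ ⟨x, hx, rfl⟩) hint
  obtain ⟨κ, _instκ, z, w, hzK, hzai, hwpos, hw1, hwz⟩ := eq_pos_convex_span_of_mem_convexHull hmem
  -- the number of atoms
  have hcard : Fintype.card κ ≤ S.card + 1 := by
    have h1 := hzai.card_le_finrank_succ
    have h2 : Module.finrank ℝ (vectorSpan ℝ (Set.range z)) ≤ Module.finrank ℝ (S → ℝ) := Submodule.finrank_le _
    have h3 : Module.finrank ℝ (S → ℝ) = S.card := by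
      rw [Module.finrank_fintype_fun_eq_card, Fintype.card_coe]
    omega
  -- the atoms in the box
  have hzK' : ∀ k, ∃ x, x ∈ K ∧ m x = z k := fun k => hzK ⟨k, rfl⟩
  choose x hxK hxz using hzK'
  -- transfer to `Fin N`
  set N := Fintype.card κ with hN
  let e : κ ≃ Fin N := Fintype.equivFin κ
  refine ⟨N, fun k => w (e.symm k), fun k => x (e.symm k), hcard, fun k => hwpos _, ?_, ?_, ?_⟩
  · rw [Equiv.sum_comp e.symm (fun k => w k)]; exact hw1
  · intro k i
    exact Set.mem_univ_pi.1 (hxK (e.symm k)) i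
  · intro j hj
    have hjS : j ∈ S := (mem_multiIndex_iff t j).2 hj
    -- evaluate the vector identity at the coordinate `⟨j, hjS⟩`
    have hcoord := congr_fun hwz ⟨j, hjS⟩
    have hL : (∑ k, w k • z k) ⟨j, hjS⟩ = ∑ k, w k * ∏ i, x k i ^ j i := by
      rw [Finset.sum_apply]
      refine Finset.sum_congr rfl fun k _ => ?_
      rw [Pi.smul_apply, smul_eq_mul, ← hxz k]
    have hR : (∫ y, m y ∂Q) ⟨j, hjS⟩ = ∫ y, ∏ i, y i ^ j i ∂Q := by
      have h := (ContinuousLinearMap.proj (R := ℝ) (φ := fun _ : S => ℝ) ⟨j, hjS⟩).integral_comp_comm hint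
      simp only [ContinuousLinearMap.proj_apply] at h
      rw [← h]
    rw [hL, hR] at hcoord
    rw [← hcoord, Equiv.sum_comp e.symm (fun k => w k * ∏ i, x k i ^ j i)]

/-- ★ TCHAKALOFF WITH THE EXPLICIT COUNT: as above with `N ≤ (e(t+d)∕d)^d + 1`. [folklore] -/
theorem exists_tchakaloff_cubature_explicit [Nonempty ι] {a b : ℝ} (Q : Measure (ι → ℝ)) [IsProbabilityMeasure Q]
    (hQ : Q (Set.pi Set.univ (fun _ : ι => Set.Icc a b))ᶜ = 0) (t : ℕ) :
    ∃ (N : ℕ) (w : Fin N → ℝ) (z : Fin N → ι → ℝ),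
      (N : ℝ) ≤ (Real.exp 1 * (t + Fintype.card ι) / Fintype.card ι) ^ Fintype.card ι + 1 ∧
      (∀ k, 0 < w k) ∧ ∑ k, w k = 1 ∧ (∀ k i, z k i ∈ Set.Icc a b) ∧
      ∀ j : ι → ℕ, ∑ i, j i ≤ t → ∑ k, w k * ∏ i, z k i ^ j i = ∫ x, ∏ i, x i ^ j i ∂Q := by
  obtain ⟨N, w, z, hN, hw, hw1, hz, hmom⟩ := exists_tchakaloff_cubature Q hQ t
  refine ⟨N, w, z, ?_, hw, hw1, hz, hmom⟩
  have h1 : (N : ℝ) ≤ (((Fintype.piFinset fun _ : ι => Finset.range (t + 1)).filter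
      fun j : ι → ℕ => ∑ i, j i ≤ t).card : ℝ) + 1 := by exact_mod_cast hN
  have h2 := card_multiIndex_le (ι := ι) t
  linarith

omit [DecidableEq ι] in
/-- Integration against a finite mixture of Dirac masses: `∫ f d(Σ_k w_k δ_{z_k}) = Σ_k w_k f(z_k)` (`w_k ≥ 0`; every `f`). [bookkeeping] -/
theorem integral_sum_smul_dirac {N : ℕ} (w : Fin N → ℝ) (hw : ∀ k, 0 ≤ w k) (z : Fin N → ι → ℝ) (f : (ι → ℝ) → ℝ) :
    ∫ x, f x ∂(∑ k, ENNReal.ofReal (w k) • Measure.dirac (z k)) = ∑ k, w k * f (z k) := by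
  classical
  have hint : ∀ k ∈ (Finset.univ : Finset (Fin N)), Integrable f (ENNReal.ofReal (w k) • Measure.dirac (z k)) := by
    intro k _
    refine Integrable.smul_measure ?_ ENNReal.ofReal_ne_top
    exact (integrable_const (f (z k))).congr (ae_eq_dirac f).symm
  rw [integral_finsetSum_measure hint]
  refine Finset.sum_congr rfl fun k _ => ?_
  rw [integral_smul_measure, integral_dirac, ENNReal.toReal_ofReal (hw k), smul_eq_mul]

/-- ★ TCHAKALOFF AS A MEASURE: a probability MEASURE `P = Σ_k w_k δ_{z_k}` carried by the box, `N ≤ (e(t+d)∕d)^d + 1` atoms, with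
`∫ f dP = Σ_k w_k f(z_k)` for every `f` and `∫∏x_i^{j_i} dP = ∫∏x_i^{j_i} dQ` for every `Σ j_i ≤ t`. [folklore] -/
theorem exists_cubature_measure [Nonempty ι] {a b : ℝ} (Q : Measure (ι → ℝ)) [IsProbabilityMeasure Q]
    (hQ : Q (Set.pi Set.univ (fun _ : ι => Set.Icc a b))ᶜ = 0) (t : ℕ) :
    ∃ (N : ℕ) (w : Fin N → ℝ) (z : Fin N → ι → ℝ) (P : Measure (ι → ℝ)), IsProbabilityMeasure P ∧
      (N : ℝ) ≤ (Real.exp 1 * (t + Fintype.card ι) / Fintype.card ι) ^ Fintype.card ι + 1 ∧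
      (∀ k, 0 < w k) ∧ ∑ k, w k = 1 ∧ (∀ k i, z k i ∈ Set.Icc a b) ∧
      P (Set.pi Set.univ (fun _ : ι => Set.Icc a b))ᶜ = 0 ∧
      (∀ f : (ι → ℝ) → ℝ, ∫ x, f x ∂P = ∑ k, w k * f (z k)) ∧
      ∀ j : ι → ℕ, ∑ i, j i ≤ t → ∫ x, ∏ i, x i ^ j i ∂P = ∫ x, ∏ i, x i ^ j i ∂Q := by
  classical
  obtain ⟨N, w, z, hN, hw, hw1, hz, hmom⟩ := exists_tchakaloff_cubature_explicit Q hQ t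
  set P : Measure (ι → ℝ) := ∑ k, ENNReal.ofReal (w k) • Measure.dirac (z k) with hP
  have hint : ∀ f : (ι → ℝ) → ℝ, ∫ x, f x ∂P = ∑ k, w k * f (z k) :=
    fun f => integral_sum_smul_dirac w (fun k => (hw k).le) z f
  have hPuniv : P Set.univ = 1 := by
    rw [hP, Measure.coe_finsetSum, Finset.sum_apply]
    simp only [Measure.smul_apply, measure_univ, smul_eq_mul, mul_one]
    rw [← ENNReal.ofReal_sum_of_nonneg (fun k _ => (hw k).le), hw1, ENNReal.ofReal_one]
  have hprob : IsProbabilityMeasure P := ⟨hPuniv⟩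
  have hKm : MeasurableSet (Set.pi Set.univ (fun _ : ι => Set.Icc a b)) :=
    MeasurableSet.univ_pi fun _ => measurableSet_Icc
  have hPK : P (Set.pi Set.univ (fun _ : ι => Set.Icc a b))ᶜ = 0 := by
    rw [hP, Measure.coe_finsetSum, Finset.sum_apply]
    refine Finset.sum_eq_zero fun k _ => ?_
    rw [Measure.smul_apply, Measure.dirac_apply' _ hKm.compl, Set.indicator_of_notMem, smul_zero]
    exact fun h => h (Set.mem_univ_pi.2 (hz k))
  refine ⟨N, w, z, P, hprob, hN, hw, hw1, hz, hPK, hint, fun j hj => ?_⟩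
  rw [hint, hmom j hj]

end Summit.QuantumFields.YangMills.Theorems.BalabanUVNodesN19TchakaloffCubature

end
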